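import Summits.CriticalPhenomena.PercolationContinuityZ3.Theorems.PercNearOneGluingNoHeavyLowerTailSahiCombMixSingleOrPrelim
import Summits.CriticalPhenomena.PercolationContinuityZ3.Theorems.PercNearOneGluingNoHeavyLowerTailSahiCombMixGrow
import Summits.CriticalPhenomena.PercolationContinuityZ3.Theorems.SahiMasterFamilyBlockStratum

/-!
# The comb hierarchy for Sahi's `E_k`, LXXI: **THE SINGLE-MEMBER OR STEP FOR EVERY `n`** — the hereditary comb class of ANY number of events ignoring `e`
# is closed under OR-ing the coordinate `e` into ONE member; growth of `n`-tuples by AND steps and single-member OR steps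

Support file of the one-cut programme (crux `NoHeavyLowerTail`, stmt-CriticalPhenomena-4575; cell `prim-masterthm`, seat P3, gen 11;
`run/shared/lean/prim/prim-masterthm/prim-masterthm-p3/HIERARCHY.md` §19(f)–(i), memo `run/shared/lean/prim/prim-masterthm/FROM-prim-masterthm-p3-g11-SINGLE-MEMBER-OR.md`).
For `U : Fin n → Set (Set ι)` ignoring `e` with `CombHereditary U` and any member `i`, EVERY row (every order `m`, every slot map) of the ∩-closed family of
`orCoord U e (sel i)` is comb-positive at multidegree `m` — uniformly in `n`, with NO monotonicity hypothesis.  PROOF = the TOUCHED-SET RECURSION (memo §5–§7;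
ingredients in `…SahiCombMixSingleOrPrelim`): induction on the number `k` of touched slots, for all orders at once.  `k = 0`: a row of `U`'s family.  `k = 1`: the
affine cell `sahiE_rowFam_affine` — `p_e·(row) + (1−p_e)·(row)`.  `k ≥ 2`: write the row as (row with the touched slot `x` made plain) − `E_m(1_{Φ_x}, rest)`
(multilinearity), move `1_{Φ_x}` to the head (`SahiMeetTowerAll.sahiE_update_eq_sahiE_cons`) and expand (`SahiMomentExpansion.sahiE_cons_eq_moment_expansion_aux`): the top
moment vanishes (a second touched slot), the moments with a touched slot in `T` vanish, and the others are `(1−p_e)·μ_p((Q_x∩Q_T)∖U_i)` times the sub-row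
`E_{|Tᶜ|}(rest|Tᶜ)`, which has `k − 1 ≥ 1` touched slots (induction) — so
`row = (row with x plain) + Σ_T |T|!·(1−p_e)·μ_p((Q_x∩Q_T)∖U_i)·E_{|Tᶜ|}(rest|Tᶜ)`, every term a product of comb-positive factors of total multidegree `≤ m`
(`CombPos.mul/mul_of_le/smul/sum`, `deg_step_le`).  Summed out, the recursion is the explicit universal certificate (★★) of the memo (verified there in exact arithmetic
for all cells with `m ≤ 8` slots); here no certificate is needed — positivity propagates through the recursion.
* `combPos_rowFam_of_card_le` — the induction;  **`combHereditary_orCoord_sel`** — `CombHereditary U → CombHereditary (orCoord U e (sel i))`, EVERY `n` (gen 8: `n ≤ 4`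
  via H-MIX(4); earlier this gen: `n = 5` via LP certificates, `…SahiCombMixFiveSingleMain`); `hereditaryAllOrders_orCoord_sel` (law-level shadow);
* **`combHereditary_grow_single`** — GROWTH FOR EVERY `n`: a `CombHereditary` family determined by `S`, grown by steps on pairwise distinct fresh coordinates each of
  which ANDs the coordinate into any sub-collection (`combHereditary_andCoord`, gen 9) or ORs it into at most ONE member, stays `CombHereditary`
  (`sahiE_grow_single_nonneg`: all rows ≥ 0 under every product measure).  E.g. any number of common-order monotone read-once decision lists in which every
  coordinate is an ACCEPTING literal of at most one list.
SHARP in the number of OR-ed members: two members fail at the law level (gen 8 `SahiMixture.not_hereditaryMixturePositivity_five`), three even for the top cell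
(gen 10 `not_singletonCell_five_three`).  HONEST FRAMING: a closure property of the hereditary comb class; nothing here asserts (M⁺-k) or `C_k` for `k ≥ 3`. [this work]
-/

noncomputable section

open scoped Classical

namespace Summit.CriticalPhenomena.PercolationContinuityZ3.Theorems

open Finset Function
open Literature.Combinatorics.Sahi2008
open Literature.Probability.Percolation.BHK2006 (ind_le_one ind_inter)
open Literature.Probability.Percolation.DecisionTree (ind ind_of_mem ind_of_not_mem ind_nonneg)
open SahiComb
open SahiCombDisjunct (orCoord)
open SahiCombHereditary (CombHereditary)
open scoped Nat

variable {ι : Type} [Fintype ι]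

namespace SahiCombMix

section SingleOr

variable {n : ℕ} (U : Fin n → Set (Set ι)) (e : ι) (i : Fin n) (hUe : ∀ (j : Fin n) (b : Bool), secAt e b (U j) = U j)

include hUe in
/-- **THE SINGLE-MEMBER OR STEP, EVERY `n` AND EVERY ORDER** (induction on the number of touched slots).  For every `k`, every order `m` and every
slot map `K : Fin m → Finset (Fin n)` with at most `k` touched slots: `p ↦ E_m(μ_p; ⋂_{l∈K_j}(orCoord U e (sel i) l))` is comb-positive at multidegree
`m`. [this work] -/
theorem combPos_rowFam_of_card_le (hU : CombHereditary U) :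
    ∀ (k m : ℕ) (K : Fin m → Finset (Fin n)), (univ.filter fun j => i ∈ K j).card ≤ k →
      CombPos (fun _ : ι => m) (fun p => sahiE (bernoulliWeight p) m (fun j => ind (⋂ l ∈ K j, orCoord U e (sel i) l))) := by
  intro k
  induction k with
  | zero =>
    intro m K hk
    have h0 : ∀ j, i ∉ K j := fun j hj => by
      have : j ∈ univ.filter fun j => i ∈ K j := Finset.mem_filter.2 ⟨Finset.mem_univ _, hj⟩
      rw [Finset.card_eq_zero.1 (Nat.le_zero.1 hk)] at this
      exact Finset.notMem_empty _ this
    rw [rowFam_eq_plain U e i K h0]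
    exact hU m K
  | succ k ih =>
    intro m K hk
    by_cases hle : (univ.filter fun j => i ∈ K j).card ≤ k
    · exact ih m K hle
    have hcard : (univ.filter fun j => i ∈ K j).card = k + 1 := by omega
    obtain ⟨x, hx⟩ : ∃ x, x ∈ univ.filter fun j => i ∈ K j :=
      Finset.card_pos.1 (by omega)
    have hxi : i ∈ K x := (Finset.mem_filter.1 hx).2
    -- the order is positive: `m = m' + 1`
    obtain ⟨m', rfl⟩ : ∃ m', m = m' + 1 := ⟨m - 1, (Nat.succ_pred_eq_of_pos (Fin.pos x)).symm⟩
    -- number of touched slots among the others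
    have hothers : (univ.filter fun y : Fin m' => i ∈ K (x.succAbove y)).card = k := by
      have := card_filter_succAbove (fun j => i ∈ K j) x hxi
      omega
    rcases Nat.eq_zero_or_pos k with hk0 | hkpos
    · -- exactly one touched slot: the affine cell
      subst hk0
      have honly : ∀ j, j ≠ x → i ∉ K j := by
        intro j hj hij
        obtain ⟨y, rfl⟩ := Fin.exists_succAbove_eq hj
        have : y ∈ univ.filter fun y : Fin m' => i ∈ K (x.succAbove y) := Finset.mem_filter.2 ⟨Finset.mem_univ _, hij⟩
        rw [Finset.card_eq_zero.1 hothers] at this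
        exact Finset.notMem_empty _ this
      have rQ := (hU.row_off e hUe (m' + 1) (update K x ((K x).erase i)))
      have rP := (hU.row_off e hUe (m' + 1) K)
      refine (((combPos_coord e).mul_of_le rQ (deg_affine_le e m')).add
        ((combPos_one_sub_coord e).mul_of_le rP (deg_affine_le e m'))).congr fun p => ?_
      exact sahiE_rowFam_affine U e i hUe K x hxi honly p
    · -- at least two touched slots: the recursion
      obtain ⟨y₀, hy₀⟩ : ∃ y₀, y₀ ∈ univ.filter fun y : Fin m' => i ∈ K (x.succAbove y) :=
        Finset.card_pos.1 (by omega)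
      have hy₀i : i ∈ K (x.succAbove y₀) := (Finset.mem_filter.1 hy₀).2
      set F : Fin (m' + 1) → Set ι → ℝ := fun j => ind (⋂ l ∈ K j, orCoord U e (sel i) l) with hF
      set Q : Set (Set ι) := ⋂ l ∈ (K x).erase i, U l with hQ
      set Φ : Set (Set ι) := (Q \ U i) ∩ {ω : Set ι | e ∉ ω} with hΦ
      -- the row with `x` made plain: `k` touched slots
      have hK' : (univ.filter fun j => i ∈ update K x ((K x).erase i) j).card ≤ k := by
        have h1 : (univ.filter fun j => i ∈ update K x ((K x).erase i) j) = (univ.filter fun j => i ∈ K j).erase x := by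
          ext j
          simp only [Finset.mem_filter, Finset.mem_univ, true_and, Finset.mem_erase]
          by_cases hj : j = x
          · subst hj; simp
          · simp [hj]
        rw [h1, Finset.card_erase_of_mem hx, hcard]
        omega
      have ihQ := ih (m' + 1) (update K x ((K x).erase i)) hK'
      rw [← update_rowFam_erase U e i K x] at ihQ
      -- the sub-rows `E_{|Tᶜ|}(g|Tᶜ)`: `k` touched slots, by induction
      have ihT : ∀ T : Finset (Fin m'), CombPos (fun _ : ι => Tᶜ.card)
          (fun p => sahiE (bernoulliWeight p) Tᶜ.card (fun j => x.removeNth F (Tᶜ.orderEmbOfFin rfl j))) := by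
        intro T
        have hle : (univ.filter fun j : Fin Tᶜ.card => i ∈ K (x.succAbove (Tᶜ.orderEmbOfFin rfl j))).card ≤ k := by
          rw [← hothers]
          exact SahiTotalCumulance.card_filter_comp_le_of_injective (fun y : Fin m' => i ∈ K (x.succAbove y)) _ (Tᶜ.orderEmbOfFin rfl).injective
        exact ih Tᶜ.card (fun j => K (x.succAbove (Tᶜ.orderEmbOfFin rfl j))) hle
      -- each term of the expansion is comb-positive at multidegree `m' + 1`
      have hterm : ∀ T : Finset (Fin m'), CombPos (fun _ : ι => m' + 1) (fun p =>
          ((T.card)! : ℝ) * (ex (bernoulliWeight p) (ind Φ * ∏ j ∈ T, x.removeNth F j)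
            * sahiE (bernoulliWeight p) Tᶜ.card (fun j => x.removeNth F (Tᶜ.orderEmbOfFin rfl j)))) := by
        intro T
        by_cases hT : ∃ y ∈ T, i ∈ K (x.succAbove y)
        · refine (CombPos.zero _).congr fun p => ?_
          rw [show ex (bernoulliWeight p) (ind Φ * ∏ j ∈ T, x.removeNth F j) = 0 from by
            rw [hΦ, hQ, show x.removeNth F = fun j => ind (⋂ l ∈ K (x.succAbove j), orCoord U e (sel i) l) from rfl,
              ex_phi_prod U e i hUe K x T p, if_pos hT]]
          ring
        · have hA : ∀ b : Bool, secAt e b ((⋂ l ∈ (K x).erase i, U l) ∩ ⋂ j ∈ T, ⋂ l ∈ K (x.succAbove j), U l)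
              = (⋂ l ∈ (K x).erase i, U l) ∩ ⋂ j ∈ T, ⋂ l ∈ K (x.succAbove j), U l := by
            intro b
            rw [secAt_inter, secAt_biInter U e hUe _ b, secAt_biInter_fam]
            congr 1
            exact Set.iInter_congr fun j => Set.iInter_congr fun _ => secAt_biInter U e hUe _ b
          have hdiff := combPos_exDiff_off e ((⋂ l ∈ (K x).erase i, U l) ∩ ⋂ j ∈ T, ⋂ l ∈ K (x.succAbove j), U l) (U i) hA (hUe i)
          have hcT : Tᶜ.card ≤ m' := by simpa using Finset.card_le_univ Tᶜ
          refine ((((combPos_one_sub_coord e).mul hdiff).mul_of_le (ihT T) (deg_step_le e m' Tᶜ.card hcT)).smul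
            (Nat.cast_nonneg _ : (0 : ℝ) ≤ ((T.card)! : ℝ))).congr fun p => ?_
          rw [show ex (bernoulliWeight p) (ind Φ * ∏ j ∈ T, x.removeNth F j)
              = (1 - (p e : ℝ)) * (ex (bernoulliWeight p) (ind ((⋂ l ∈ (K x).erase i, U l) ∩ ⋂ j ∈ T, ⋂ l ∈ K (x.succAbove j), U l))
                - ex (bernoulliWeight p) (ind (U i ∩ ((⋂ l ∈ (K x).erase i, U l) ∩ ⋂ j ∈ T, ⋂ l ∈ K (x.succAbove j), U l)))) from by
            rw [hΦ, hQ, show x.removeNth F = fun j => ind (⋂ l ∈ K (x.succAbove j), orCoord U e (sel i) l) from rfl,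
              ex_phi_prod U e i hUe K x T p, if_neg hT]]
      -- the top moment vanishes (another touched slot `y₀`)
      have htop : ∀ p : ι → unitInterval, ex (bernoulliWeight p) (ind Φ * ∏ j, x.removeNth F j) = 0 := by
        intro p
        rw [hΦ, hQ, show x.removeNth F = fun j => ind (⋂ l ∈ K (x.succAbove j), orCoord U e (sel i) l) from rfl,
          ex_phi_prod U e i hUe K x univ p, if_pos ⟨y₀, Finset.mem_univ _, hy₀i⟩]
      -- assemble
      refine (ihQ.add (CombPos.sum (univ.filter fun T : Finset (Fin m') => T ≠ univ) fun T _ => hterm T)).congr fun p => ?_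
      have hFx : update F x ((1 : ℝ) • ind Q + (-1 : ℝ) • ind Φ) = F := by
        rw [show (1 : ℝ) • ind Q + (-1 : ℝ) • ind Φ = ind Q - ind Φ from by funext ω; simp; ring,
          ← ind_slot_touched U e i (K x) hxi]
        exact update_eq_self x F
      have hlin := sahiE_update_lin (bernoulliWeight p) (m' + 1) F x 1 (-1) (ind Q) (ind Φ)
      rw [hFx] at hlin
      rw [hlin, SahiMeetTowerAll.sahiE_update_eq_sahiE_cons (bernoulliWeight p) m' F x (ind Φ),
        SahiMomentExpansion.sahiE_cons_eq_moment_expansion_aux, htop p]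
      simp only [hF, hQ, hΦ]
      ring

include hUe in
/-- **THE SINGLE-MEMBER OR STEP FOR EVERY `n`.**  For every finite cube, every family `U_0,…,U_{n−1}` of events ignoring `e` whose ∩-closed family is
comb-positive at every order, and every member `i`: OR-ing the coordinate event `{e ∈ ω}` into `U_i` alone gives again a `CombHereditary` family.
No monotonicity is needed. [this work] -/
theorem combHereditary_orCoord_sel (hU : CombHereditary U) : CombHereditary (orCoord U e (sel i)) :=
  fun m K => combPos_rowFam_of_card_le U e i hUe hU _ m K le_rfl

include hUe in
/-- Law-level shadow: every row of the single-OR-ed family is nonnegative under every product measure. [this work] -/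
theorem hereditaryAllOrders_orCoord_sel (hU : CombHereditary U) (p : ι → unitInterval) :
    SahiMixture.HereditaryAllOrders (bernoulliWeight p) (orCoord U e (sel i)) :=
  (combHereditary_orCoord_sel U e i hUe hU).hereditaryAllOrders p

end SingleOr

/-! ### Growth of `n`-tuples by AND steps and single-member OR steps -/

section Grow

open Literature.Probability.Percolation (DeterminedBy)
open SahiCombHereditary (MixStep grow mixStep combHereditary_andCoord isUpperSet_grow secAt_grow_of_notMem)

/-- **GROWING `n` HEREDITARILY COMB-POSITIVE EVENTS.**  Let `U_0,…,U_{n−1}` be events determined by the coordinate set `S` with `CombHereditary U`.  Every step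
list reading pairwise distinct coordinates outside `S`, whose AND steps select arbitrary sub-collections and whose OR steps select at most ONE member each,
grows `U` into a `CombHereditary` family — for EVERY `n`. [this work] -/
theorem combHereditary_grow_single {n : ℕ} {U : Fin n → Set (Set ι)} {S : Set ι} (hUS : ∀ j, DeterminedBy (U j) S)
    (hU : CombHereditary U) :
    ∀ (L : List (MixStep ι n)), (L.map MixStep.coord).Nodup → (∀ s ∈ L, s.coord ∉ S) → (∀ s ∈ L, s.op = true → ∃ i, s.sel = sel i) →
      CombHereditary (grow U L)
  | [], _, _, _ => hU
  | s :: L, hL, hS, h1 => by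
    rw [List.map_cons, List.nodup_cons] at hL
    have ih := combHereditary_grow_single hUS hU L hL.2 (fun t ht => hS t (List.mem_cons_of_mem s ht))
      fun t ht => h1 t (List.mem_cons_of_mem s ht)
    have hig := secAt_grow_of_notMem hUS L (hS s List.mem_cons_self) hL.1
    show CombHereditary (mixStep (grow U L) s)
    unfold mixStep
    cases hop : s.op
    · exact combHereditary_andCoord _ s.coord s.sel hig ih
    · obtain ⟨i, hi⟩ := h1 s List.mem_cons_self hop
      rw [hi]
      exact combHereditary_orCoord_sel _ s.coord i hig ih

/-- Law-level shadow of `combHereditary_grow_single`. [this work] -/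
theorem sahiE_grow_single_nonneg {n : ℕ} {U : Fin n → Set (Set ι)} {S : Set ι} (hUS : ∀ j, DeterminedBy (U j) S)
    (hU : CombHereditary U) (L : List (MixStep ι n)) (hL : (L.map MixStep.coord).Nodup) (hS : ∀ s ∈ L, s.coord ∉ S)
    (h1 : ∀ s ∈ L, s.op = true → ∃ i, s.sel = sel i) (p : ι → unitInterval) (m : ℕ) (K : Fin m → Finset (Fin n)) :
    0 ≤ sahiE (bernoulliWeight p) m (fun j => ind (⋂ i ∈ K j, grow U L i)) :=
  ((combHereditary_grow_single hUS hU L hL hS h1).hereditaryAllOrders p) m K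

end Grow

end SahiCombMix

end Summit.CriticalPhenomena.PercolationContinuityZ3.Theorems

end
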